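/-
Copyright (c) 2026. All rights reserved.
Released under Apache 2.0 license as described in the file LICENSE.
Authors: abc-iut cell, campaign-S prover seat abc-iut-S1 (wave 1).
-/
import Literature.IUT.LogVolume.RamificationInvariants
import Literature.IUT.LogVolume.IntegerRing
import HarnessLib

/-!
# A subfield `ℚ_p ⊆ k₀ ⊆ K`: `e₀ ∣ e` and `𝒪_{k₀} → 𝒪_K`

Support for [IUTchIV] Proposition 1.3 (kurims p. 11: "Suppose that `k_0 ⊆ k_i` is a subfield that contains
`ℚ_p` … `e_{i/0} := e_i/e_0 (∈ ℤ)`"), typed in `DifferentEstimates.lean` with the subfield as a separate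
norm-side MLF `k₀` and `[NormedAlgebra k₀ K]` (an isometric embedding `k₀ → K`).  PROVED here:

* `norm_algebraMap_eq` — `‖x‖_K = ‖x‖_{k₀}`; `absRamificationIdx_dvd` — **`e_0 ∣ e_i`** (the value group
  `p^{(1/e₀)ℤ}` of `k₀` sits inside the value group `p^{(1/e)ℤ}` of `K`), so `e_{i/0} = e_i/e_0 ∈ ℤ` and
  `e_i = e_{i/0}·e_0` (`absRamificationIdx_eq_mul`);
* `integerHomOfAlgebra : 𝒪_{k₀} →+* 𝒪_K` and the SCOPED instances `Algebra 𝒪_{k₀} 𝒪_K`,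
  `IsScalarTower 𝒪_{k₀} 𝒪_K K`, `IsScalarTower ℤ_[p] 𝒪_{k₀} 𝒪_K` (given `IsScalarTower ℚ_[p] k₀ K`) —
  the data Mathlib's relative `differentIdeal 𝒪_{k₀} 𝒪_K` and its transitivity formula need.

Classical; nothing disputed.
-/

noncomputable section

open Metric Set IsLocalRing
open scoped NormedField

namespace Literature.IUT.LogVolume

open Literature.NumberTheory.GaloisRepresentations.Ultrametric

variable (p : ℕ) [Fact p.Prime]
variable (k₀ : Type*) [NontriviallyNormedField k₀] [inst₀ : NormedAlgebra ℚ_[p] k₀] [IsUltrametricDist k₀]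
  [ProperSpace k₀]
variable (K : Type*) [NontriviallyNormedField K] [instK : NormedAlgebra ℚ_[p] K] [IsUltrametricDist K]
  [ProperSpace K]
variable [instA : NormedAlgebra k₀ K]

omit inst₀ [IsUltrametricDist k₀] [ProperSpace k₀] instK [IsUltrametricDist K] [ProperSpace K] in
/-- The embedding `k₀ → K` of a normed algebra is isometric: `‖x‖_K = ‖x‖_{k₀}`.
[claim: Mochizuki2012, status: disputed] -/
theorem norm_algebraMap_eq (x : k₀) : ‖algebraMap k₀ K x‖ = ‖x‖ := norm_algebraMap' K x

/-! ## `e₀ ∣ e` -/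

include inst₀ instK instA in
/-- **`e_0 ∣ e_i`** for `ℚ_p ⊆ k_0 ⊆ k_i` ([IUTchIV] Prop. 1.3: "`e_{i/0} := e_i/e_0 (∈ ℤ)`"): a uniformizer
of `k₀` has norm `p^{−1/e₀}`, which is a value `p^{−m/e}` of `K`. [claim: Mochizuki2012, status: disputed] -/
theorem absRamificationIdx_dvd : absRamificationIdx p k₀ ∣ absRamificationIdx p K := by
  have hp1 : (1 : ℝ) < p := by exact_mod_cast (Fact.out : p.Prime).one_lt
  have hp0 : (0 : ℝ) < p := by linarith
  obtain ⟨ϖ, hϖ⟩ := exists_isUniformizer (F := k₀)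
  set e₀ := absRamificationIdx p k₀ with he₀
  set e := absRamificationIdx p K with he
  have he₀0 : (0 : ℝ) < e₀ := by exact_mod_cast absRamificationIdx_pos p k₀
  have he0 : (0 : ℝ) < e := by exact_mod_cast absRamificationIdx_pos p K
  -- `‖ϖ‖ = p^{-1/e₀}` in `k₀`, and `= p^{-m/e}` in `K`
  have h₀ : ‖(ϖ : k₀)‖ = (p : ℝ) ^ (-(1 / (e₀ : ℝ))) := norm_eq_rpow_of_isUniformizer p k₀ hϖ
  have hx0 : algebraMap k₀ K (ϖ : k₀) ≠ 0 := by
    rw [map_ne_zero]; exact ϖ.ne_zero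
  obtain ⟨m, hm⟩ := exists_norm_eq_rpow p K hx0
  rw [norm_algebraMap_eq k₀ K, h₀] at hm
  -- compare exponents
  have hexp : -(1 / (e₀ : ℝ)) = -((m : ℝ) / e) := by
    have := congrArg (Real.logb p) hm
    rwa [Real.logb_rpow hp0 hp1.ne', Real.logb_rpow hp0 hp1.ne'] at this
  have hme : (e : ℝ) = m * e₀ := by
    field_simp at hexp
    linarith
  have hm0 : 0 < m := by
    have : (0 : ℝ) < m * e₀ := by rw [← hme]; exact he0
    exact_mod_cast (pos_of_mul_pos_left this he₀0.le)
  refine ⟨m.toNat, ?_⟩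
  have : (e : ℤ) = m * e₀ := by exact_mod_cast hme
  have hmn : (m.toNat : ℤ) = m := Int.toNat_of_nonneg hm0.le
  zify
  rw [hmn, this, mul_comm]

include inst₀ instK instA in
/-- `e_i = e_{i/0} · e_0` with `e_{i/0} = e_i / e_0`. [claim: Mochizuki2012, status: disputed] -/
theorem absRamificationIdx_eq_mul :
    absRamificationIdx p K = (absRamificationIdx p K / absRamificationIdx p k₀) * absRamificationIdx p k₀ :=
  (Nat.div_mul_cancel (absRamificationIdx_dvd p k₀ K)).symm

/-! ## `𝒪_{k₀} → 𝒪_K` -/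

omit inst₀ [ProperSpace k₀] instK [ProperSpace K] in
/-- The isometric embedding maps integers to integers. [claim: Mochizuki2012, status: disputed] -/
theorem algebraMap_mem_integer (x : Valued.integer k₀) : algebraMap k₀ K (x : k₀) ∈ Valued.integer K :=
  Valued.integer.mem_iff.mpr (by rw [norm_algebraMap_eq k₀ K]; exact Valued.integer.norm_le_one x)

/-- **`𝒪_{k₀} → 𝒪_K`**, the restriction of `k₀ → K`. [claim: Mochizuki2012, status: disputed] -/
def integerHomOfAlgebra : Valued.integer k₀ →+* Valued.integer K :=
  ((algebraMap k₀ K).comp (Valued.integer k₀).subtype).codRestrict (Valued.integer K)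
    (algebraMap_mem_integer k₀ K)

omit inst₀ [ProperSpace k₀] instK [ProperSpace K] in
/-- On underlying elements `𝒪_{k₀} → 𝒪_K` is `k₀ → K`. [claim: Mochizuki2012, status: disputed] -/
@[simp] theorem coe_integerHomOfAlgebra (x : Valued.integer k₀) :
    ((integerHomOfAlgebra k₀ K x : Valued.integer K) : K) = algebraMap k₀ K (x : k₀) := rfl

/-- **`𝒪_K` as an `𝒪_{k₀}`-algebra** (scoped instance). [claim: Mochizuki2012, status: disputed] -/
scoped instance algebraInteger : Algebra (Valued.integer k₀) (Valued.integer K) :=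
  (integerHomOfAlgebra k₀ K).toAlgebra

omit inst₀ [ProperSpace k₀] instK [ProperSpace K] in
/-- The structure map is injective. [claim: Mochizuki2012, status: disputed] -/
theorem integerHomOfAlgebra_injective : Function.Injective (integerHomOfAlgebra k₀ K) := by
  intro x y h
  have h' := congrArg (fun z : Valued.integer K ↦ (z : K)) h
  simp only [coe_integerHomOfAlgebra] at h'
  exact Subtype.ext ((algebraMap k₀ K).injective h')

/-- The tower `𝒪_{k₀} → 𝒪_K → K`. [claim: Mochizuki2012, status: disputed] -/
scoped instance isScalarTower_integer_integer :
    IsScalarTower (Valued.integer k₀) (Valued.integer K) K :=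
  IsScalarTower.of_algebraMap_eq fun _ ↦ rfl

/-- The tower `𝒪_{k₀} → k₀ → K`. [claim: Mochizuki2012, status: disputed] -/
scoped instance isScalarTower_integer_field :
    IsScalarTower (Valued.integer k₀) k₀ K :=
  IsScalarTower.of_algebraMap_eq fun _ ↦ rfl

omit [ProperSpace k₀] [ProperSpace K] in
include inst₀ instK in
/-- The tower `ℤ_p → 𝒪_{k₀} → 𝒪_K` (when the `ℚ_p`-structures are compatible).
[claim: Mochizuki2012, status: disputed] -/
theorem isScalarTower_padicInt_integer [IsScalarTower ℚ_[p] k₀ K] :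
    IsScalarTower ℤ_[p] (Valued.integer k₀) (Valued.integer K) := by
  refine IsScalarTower.of_algebraMap_eq fun x ↦ Subtype.ext ?_
  change algebraMap ℚ_[p] K (x : ℚ_[p]) = algebraMap k₀ K (algebraMap ℚ_[p] k₀ (x : ℚ_[p]))
  rw [← IsScalarTower.algebraMap_apply]

/-- `𝒪_K` is torsion-free over `𝒪_{k₀}`. [claim: Mochizuki2012, status: disputed] -/
scoped instance isTorsionFree_integer_integer :
    Module.IsTorsionFree (Valued.integer k₀) (Valued.integer K) :=
  Module.isTorsionFree_iff_algebraMap_injective.mpr (integerHomOfAlgebra_injective k₀ K)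

end Literature.IUT.LogVolume

end
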